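import Summits.Ventures.PercRepro.S1TriangleSevenD

/-!
# PercRepro — `P(7) = 11`, PART 4: CASE B — twelve points, every point on three triangles (p2, gen 17)

The hyperplane `H = cl(C)` of the cone of `x` has `≤ 10` points (C3); a triangle with two points in `H` lies in `H`,
so every triangle through an outside point has a second outside point and `|E ∖ H| ≥ 4`, `|H| ≤ 8`; the triangles
meeting `E ∖ H` number at most `3|E ∖ H|/2`, so at least `12 − 3 − ⌊3|E ∖ H|/2⌋` triangles lie inside `H` and avoid
`x`. With `|H| = 7` such a triangle lies in the cone (PART 2: impossible); with `|H| = 8` every such triangle contains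
the eighth point `v`, so the three triangles through `v` cover `C ∖ {x}` (PART 3: impossible).

* **`not_all_degree_three_of_twelve_triangles`** — CASE B.
Axioms: standard.
-/

open scoped Matroid

namespace PercRepro

namespace S1

open Set

variable {α : Type}

/-- **CASE B**: a matroid of nullity `7` with twelve triangles on twelve points, every point on exactly three
triangles, is impossible under (C1), (C2), (C3). -/
theorem not_all_degree_three_of_twelve_triangles (M : Matroid α) [M.Finite]
    (hC1 : ∀ L ⊆ M.E, M.eRk L = 2 → L.ncard ≤ 3) (hC2 : ∀ P ⊆ M.E, M.eRk P ≤ 3 → P.ncard ≤ 6)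
    (hC3 : ∀ X ⊆ M.E, M.eRk X ≤ 4 → X.ncard ≤ 10)
    (hs12 : (ThmN.triangles M).ncard = 12) (hm12 : M.E.ncard = 12)
    (hdeg : ∀ y ∈ M.E, (ThmN.trianglesThrough M y).ncard = 3) : False := by
  classical
  have hTfin : ∀ z, (ThmN.trianglesThrough M z).Finite :=
    fun z => M.ground_finite.finite_subsets.subset (fun C hC => hC.1.subset_ground)
  have hSfin : (ThmN.triangles M).Finite :=
    M.ground_finite.finite_subsets.subset (fun C hC => hC.1.subset_ground)
  -- a point `x`, its three lines, the cone `C` and the hyperplane `H`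
  obtain ⟨x, hxE⟩ : M.E.Nonempty := by
    rw [← Set.ncard_pos M.ground_finite]; omega
  have hx3 := hdeg x hxE
  obtain ⟨L₁, L₂, L₃, h12, h13, h23, hLset⟩ := Set.ncard_eq_three.1 hx3
  have h1 : L₁ ∈ ThmN.trianglesThrough M x := by rw [hLset]; simp
  have h2 : L₂ ∈ ThmN.trianglesThrough M x := by rw [hLset]; simp
  have h3 : L₃ ∈ ThmN.trianglesThrough M x := by rw [hLset]; simp
  have hx : M.IsNonloop x := by
    rw [← _root_.Matroid.indep_singleton]
    refine h1.1.ssubset_indep ?_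
    refine (Set.singleton_subset_iff.2 h1.2.2).ssubset_of_ne ?_
    intro h
    have := congrArg Set.ncard h
    rw [Set.ncard_singleton, h1.2.1] at this
    omega
  have hthree' : ∀ L ∈ ThmN.trianglesThrough M x, L = L₁ ∨ L = L₂ ∨ L = L₃ := by
    intro L hL
    rw [hLset] at hL
    simp only [Set.mem_insert_iff, Set.mem_singleton_iff] at hL
    exact hL
  obtain ⟨hn7, hr4⟩ := cone_ncard_eRk M hC1 hC2 hx h1 h2 h3 h12 h13 h23
  have hCE : L₁ ∪ L₂ ∪ L₃ ⊆ M.E :=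
    Set.union_subset (Set.union_subset h1.1.subset_ground h2.1.subset_ground) h3.1.subset_ground
  have hCfin : (L₁ ∪ L₂ ∪ L₃).Finite := M.ground_finite.subset hCE
  have hCH : L₁ ∪ L₂ ∪ L₃ ⊆ M.closure (L₁ ∪ L₂ ∪ L₃) := M.subset_closure _ hCE
  have hHE : M.closure (L₁ ∪ L₂ ∪ L₃) ⊆ M.E := M.closure_subset_ground _
  have hHfin : (M.closure (L₁ ∪ L₂ ∪ L₃)).Finite := M.ground_finite.subset hHE
  have hH10 : (M.closure (L₁ ∪ L₂ ∪ L₃)).ncard ≤ 10 := by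
    refine hC3 _ hHE ?_
    rw [M.eRk_closure_eq, hr4]
  have hH7 : 7 ≤ (M.closure (L₁ ∪ L₂ ∪ L₃)).ncard := by
    have := Set.ncard_le_ncard hCH hHfin; omega
  have hYH : (M.E \ M.closure (L₁ ∪ L₂ ∪ L₃)).ncard + (M.closure (L₁ ∪ L₂ ∪ L₃)).ncard = M.E.ncard :=
    Set.ncard_sdiff_add_ncard_of_subset hHE M.ground_finite
  have hYfin : (M.E \ M.closure (L₁ ∪ L₂ ∪ L₃)).Finite := M.ground_finite.subset Set.sdiff_subset
  -- a triangle with two points in `H` lies in `H`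
  have hinH : ∀ T ∈ ThmN.triangles M, ∀ a ∈ T, ∀ b ∈ T, a ≠ b →
      a ∈ M.closure (L₁ ∪ L₂ ∪ L₃) → b ∈ M.closure (L₁ ∪ L₂ ∪ L₃) → T ⊆ M.closure (L₁ ∪ L₂ ∪ L₃) := by
    intro T hT a ha b hb hab haH hbH
    have := triangle_subset_closure_pair M hT ha hb hab
    have hpair : ({a, b} : Set α) ⊆ M.closure (L₁ ∪ L₂ ∪ L₃) :=
      Set.insert_subset haH (Set.singleton_subset_iff.2 hbH)
    exact this.trans ((M.closure_subset_closure hpair).trans (by rw [M.closure_closure]))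
  -- every triangle through an outside point has a second outside point
  have hout : ∀ y ∈ M.E \ M.closure (L₁ ∪ L₂ ∪ L₃), ∀ T ∈ ThmN.trianglesThrough M y,
      ∃ z ∈ T, z ≠ y ∧ z ∉ M.closure (L₁ ∪ L₂ ∪ L₃) := by
    intro y hy T hT
    by_contra hno
    push Not at hno
    have h2' : (T \ {y}).ncard = 2 := by rw [Set.ncard_sdiff_singleton_of_mem hT.2.2, hT.2.1]
    obtain ⟨a, b, hab, hTab⟩ := Set.ncard_eq_two.1 h2'
    have ha : a ∈ T \ {y} := by rw [hTab]; simp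
    have hb : b ∈ T \ {y} := by rw [hTab]; simp
    have haH := hno a ha.1 (fun h => ha.2 (by rw [Set.mem_singleton_iff]; exact h))
    have hbH := hno b hb.1 (fun h => hb.2 (by rw [Set.mem_singleton_iff]; exact h))
    exact hy.2 (hinH T ⟨hT.1, hT.2.1⟩ a ha.1 b hb.1 hab haH hbH hT.2.2)
  -- `|Y'| ≥ 4`
  have hY4 : 4 ≤ (M.E \ M.closure (L₁ ∪ L₂ ∪ L₃)).ncard := by
    obtain ⟨y, hy⟩ : (M.E \ M.closure (L₁ ∪ L₂ ∪ L₃)).Nonempty := by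
      rw [← Set.ncard_pos hYfin]; omega
    obtain ⟨f, hf⟩ : ∃ f : Set α → α, ∀ T ∈ ThmN.trianglesThrough M y,
        f T ∈ T ∧ f T ≠ y ∧ f T ∉ M.closure (L₁ ∪ L₂ ∪ L₃) :=
      ⟨fun T => if h : ∃ z ∈ T, z ≠ y ∧ z ∉ M.closure (L₁ ∪ L₂ ∪ L₃) then h.choose else y,
        fun T hT => by
          have h := hout y hy T hT
          simp only [dif_pos h]
          exact h.choose_spec⟩
    have hinj : (ThmN.trianglesThrough M y).ncard ≤ ((M.E \ M.closure (L₁ ∪ L₂ ∪ L₃)) \ {y}).ncard := by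
      refine Set.ncard_le_ncard_of_injOn f ?_ ?_ (hYfin.subset Set.sdiff_subset)
      · intro T hT
        obtain ⟨ha, hb, hc⟩ := hf T hT
        exact ⟨⟨hT.1.subset_ground ha, hc⟩, fun h => hb (Set.mem_singleton_iff.1 h)⟩
      · intro T₁ hT₁ T₂ hT₂ hfe
        by_contra hne
        have hinter := ThmN.inter_eq_singleton_of_mem_trianglesThrough M hC1 hT₁ hT₂ hne
        have hmem : f T₂ ∈ T₁ ∩ T₂ := ⟨by rw [← hfe]; exact (hf T₁ hT₁).1, (hf T₂ hT₂).1⟩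
        rw [hinter, Set.mem_singleton_iff] at hmem
        exact (hf T₂ hT₂).2.1 hmem
    rw [hdeg y hy.1, Set.ncard_sdiff_singleton_of_mem hy] at hinj
    omega
  -- the triangles meeting `Y'` number at most `3|Y'|/2`
  have hS : {T ∈ ThmN.triangles M | ∃ z ∈ T, z ∉ M.closure (L₁ ∪ L₂ ∪ L₃)} ⊆ ThmN.triangles M :=
    fun T hT => hT.1
  have hrowS : ∀ T ∈ {T ∈ ThmN.triangles M | ∃ z ∈ T, z ∉ M.closure (L₁ ∪ L₂ ∪ L₃)},
      2 ≤ (T ∩ (M.E \ M.closure (L₁ ∪ L₂ ∪ L₃))).ncard := by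
    intro T hT
    obtain ⟨z, hzT, hzH⟩ := hT.2
    have hzE : z ∈ M.E := hT.1.1.subset_ground hzT
    obtain ⟨w, hwT, hwz, hwH⟩ := hout z ⟨hzE, hzH⟩ T ⟨hT.1.1, hT.1.2, hzT⟩
    have hsub : ({z, w} : Set α) ⊆ T ∩ (M.E \ M.closure (L₁ ∪ L₂ ∪ L₃)) := by
      intro u hu
      simp only [Set.mem_insert_iff, Set.mem_singleton_iff] at hu
      rcases hu with rfl | rfl
      · exact ⟨hzT, hzE, hzH⟩
      · exact ⟨hwT, hT.1.1.subset_ground hwT, hwH⟩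
    have hfin : (T ∩ (M.E \ M.closure (L₁ ∪ L₂ ∪ L₃))).Finite :=
      (M.ground_finite.subset hT.1.1.subset_ground).subset Set.inter_subset_left
    have := Set.ncard_le_ncard hsub hfin
    rw [Set.ncard_pair (Ne.symm hwz)] at this
    exact this
  have hcolS : ∀ y ∈ M.E \ M.closure (L₁ ∪ L₂ ∪ L₃), (ThmN.trianglesThrough M y).ncard ≤ 3 :=
    fun y hy => (hdeg y hy.1).le
  have hS2 := two_mul_ncard_le_three_mul_of_two_points M hS Set.sdiff_subset hrowS hcolS
  -- the triangles inside `H` avoiding `x`: at least `12 − |S| − 3` of them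
  have hJcard : 12 ≤ {T ∈ ThmN.triangles M | ∃ z ∈ T, z ∉ M.closure (L₁ ∪ L₂ ∪ L₃)}.ncard + 3 +
      {T ∈ ThmN.triangles M | T ⊆ M.closure (L₁ ∪ L₂ ∪ L₃) ∧ x ∉ T}.ncard := by
    have hsub : ThmN.triangles M ⊆ {T ∈ ThmN.triangles M | ∃ z ∈ T, z ∉ M.closure (L₁ ∪ L₂ ∪ L₃)} ∪
        ThmN.trianglesThrough M x ∪ {T ∈ ThmN.triangles M | T ⊆ M.closure (L₁ ∪ L₂ ∪ L₃) ∧ x ∉ T} := by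
      intro T hT
      by_cases hmeet : ∃ z ∈ T, z ∉ M.closure (L₁ ∪ L₂ ∪ L₃)
      · exact Or.inl (Or.inl ⟨hT, hmeet⟩)
      · push Not at hmeet
        by_cases hxT : x ∈ T
        · exact Or.inl (Or.inr ⟨hT.1, hT.2, hxT⟩)
        · exact Or.inr ⟨hT, hmeet, hxT⟩
    have hf1 : {T ∈ ThmN.triangles M | ∃ z ∈ T, z ∉ M.closure (L₁ ∪ L₂ ∪ L₃)}.Finite := hSfin.subset hS
    have hf3 : {T ∈ ThmN.triangles M | T ⊆ M.closure (L₁ ∪ L₂ ∪ L₃) ∧ x ∉ T}.Finite :=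
      hSfin.subset (fun T hT => hT.1)
    have hle := Set.ncard_le_ncard hsub ((hf1.union (hTfin x)).union hf3)
    have hu1 := Set.ncard_union_le ({T ∈ ThmN.triangles M | ∃ z ∈ T, z ∉ M.closure (L₁ ∪ L₂ ∪ L₃)} ∪
        ThmN.trianglesThrough M x) {T ∈ ThmN.triangles M | T ⊆ M.closure (L₁ ∪ L₂ ∪ L₃) ∧ x ∉ T}
    have hu2 := Set.ncard_union_le {T ∈ ThmN.triangles M | ∃ z ∈ T, z ∉ M.closure (L₁ ∪ L₂ ∪ L₃)}
        (ThmN.trianglesThrough M x)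
    rw [hs12] at hle
    rw [hx3] at hu2
    omega
  have hJC : ∀ T ∈ {T ∈ ThmN.triangles M | T ⊆ M.closure (L₁ ∪ L₂ ∪ L₃) ∧ x ∉ T},
      T ⊆ L₁ ∪ L₂ ∪ L₃ → False := fun T hT hTC =>
    no_triangle_in_cone_avoiding_apex M hC1 hC2 hx hx3 h1 h2 h3 h12 h13 h23 hT.1 hTC hT.2.2
  have hJfin : {T ∈ ThmN.triangles M | T ⊆ M.closure (L₁ ∪ L₂ ∪ L₃) ∧ x ∉ T}.Finite :=
    hSfin.subset (fun T hT => hT.1)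
  rcases Nat.lt_or_ge (M.closure (L₁ ∪ L₂ ∪ L₃)).ncard 8 with hH7' | hH8
  · -- `|H| = 7`: `H = C`, and an inside triangle avoiding `x` exists
    have hHC : M.closure (L₁ ∪ L₂ ∪ L₃) = L₁ ∪ L₂ ∪ L₃ :=
      (Set.eq_of_subset_of_ncard_le hCH (by omega) hHfin).symm
    obtain ⟨T, hT⟩ : {T ∈ ThmN.triangles M | T ⊆ M.closure (L₁ ∪ L₂ ∪ L₃) ∧ x ∉ T}.Nonempty := by
      rw [← Set.ncard_pos hJfin]; omega
    exact hJC T hT (hT.2.1.trans hHC.le)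
  · -- `|H| = 8`: `H = C ∪ {v}` and at least three inside triangles avoid `x`, all through `v`
    have hH8' : (M.closure (L₁ ∪ L₂ ∪ L₃)).ncard = 8 := by omega
    have hJ3 : 3 ≤ {T ∈ ThmN.triangles M | T ⊆ M.closure (L₁ ∪ L₂ ∪ L₃) ∧ x ∉ T}.ncard := by omega
    have hv1 : (M.closure (L₁ ∪ L₂ ∪ L₃) \ (L₁ ∪ L₂ ∪ L₃)).ncard = 1 := by
      rw [Set.ncard_sdiff hCH hCfin, hH8', hn7]
    obtain ⟨v, hv⟩ := Set.ncard_eq_one.1 hv1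
    have hvH : v ∈ M.closure (L₁ ∪ L₂ ∪ L₃) := by
      have : v ∈ M.closure (L₁ ∪ L₂ ∪ L₃) \ (L₁ ∪ L₂ ∪ L₃) := by rw [hv]; exact Set.mem_singleton v
      exact this.1
    have hvC : v ∉ L₁ ∪ L₂ ∪ L₃ := by
      have : v ∈ M.closure (L₁ ∪ L₂ ∪ L₃) \ (L₁ ∪ L₂ ∪ L₃) := by rw [hv]; exact Set.mem_singleton v
      exact this.2
    have hvE : v ∈ M.E := hHE hvH
    have hHsub : ∀ z ∈ M.closure (L₁ ∪ L₂ ∪ L₃), z ∉ L₁ ∪ L₂ ∪ L₃ → z = v := by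
      intro z hzH hzC
      have : z ∈ M.closure (L₁ ∪ L₂ ∪ L₃) \ (L₁ ∪ L₂ ∪ L₃) := ⟨hzH, hzC⟩
      rw [hv] at this
      exact this
    -- every inside triangle avoiding `x` contains `v`
    have hJv : ∀ T ∈ {T ∈ ThmN.triangles M | T ⊆ M.closure (L₁ ∪ L₂ ∪ L₃) ∧ x ∉ T}, v ∈ T := by
      intro T hT
      by_contra hvT
      apply hJC T hT
      intro z hz
      by_contra hzC
      exact hvT ((hHsub z (hT.2.1 hz) hzC) ▸ hz)
    have hJsub : {T ∈ ThmN.triangles M | T ⊆ M.closure (L₁ ∪ L₂ ∪ L₃) ∧ x ∉ T} ⊆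
        ThmN.trianglesThrough M v := fun T hT => ⟨hT.1.1, hT.1.2, hJv T hT⟩
    have hJeq : {T ∈ ThmN.triangles M | T ⊆ M.closure (L₁ ∪ L₂ ∪ L₃) ∧ x ∉ T} =
        ThmN.trianglesThrough M v :=
      Set.eq_of_subset_of_ncard_le hJsub (by rw [hdeg v hvE]; exact hJ3) (hTfin v)
    -- the three triangles through `v` lie in `H ∖ {x}` and cover it (`7` points)
    have hv3 := hdeg v hvE
    obtain ⟨T₁, T₂, T₃, hT12, hT13, hT23, hTv⟩ := Set.ncard_eq_three.1 hv3
    have hvT : ∀ T ∈ ThmN.trianglesThrough M v, T ⊆ M.closure (L₁ ∪ L₂ ∪ L₃) ∧ x ∉ T := by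
      intro T hT
      have : T ∈ {T ∈ ThmN.triangles M | T ⊆ M.closure (L₁ ∪ L₂ ∪ L₃) ∧ x ∉ T} := by
        rw [hJeq]; exact hT
      exact this.2
    have hvnl : M.IsNonloop v := by
      rw [← _root_.Matroid.indep_singleton]
      have hT₁ : T₁ ∈ ThmN.trianglesThrough M v := by rw [hTv]; simp
      refine hT₁.1.ssubset_indep ?_
      refine (Set.singleton_subset_iff.2 hT₁.2.2).ssubset_of_ne ?_
      intro h
      have := congrArg Set.ncard h
      rw [Set.ncard_singleton, hT₁.2.1] at this
      omega
    have hcoverU : ({v} ∪ ⋃ T ∈ ({T₁, T₂, T₃} : Finset (Set α)), T).ncard = 7 := by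
      have hs3 : ∀ T ∈ ({T₁, T₂, T₃} : Finset (Set α)), T ∈ ThmN.trianglesThrough M v := by
        intro T hT
        simp only [Finset.mem_insert, Finset.mem_singleton] at hT
        rcases hT with rfl | rfl | rfl <;> (rw [hTv]; simp)
      have hcard3 : ({T₁, T₂, T₃} : Finset (Set α)).card = 3 := by
        rw [Finset.card_insert_of_notMem, Finset.card_pair hT23]
        simp only [Finset.mem_insert, Finset.mem_singleton, not_or]
        exact ⟨hT12, hT13⟩
      obtain ⟨-, hn⟩ := ThmN.eRk_le_and_ncard_eq_of_triangles M hC1 hvnl _ hs3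
      rw [hn, hcard3]
    -- `{v} ∪ T₁ ∪ T₂ ∪ T₃ ⊆ H ∖ {x}`, both of `7` points: every point of `C ∖ {x}` lies on a triangle through `v`
    have hcover : ∀ z ∈ L₁ ∪ L₂ ∪ L₃, z ≠ x → z ∈ T₁ ∨ z ∈ T₂ ∨ z ∈ T₃ := by
      intro z hzC hzx
      have hsubU : ({v} ∪ ⋃ T ∈ ({T₁, T₂, T₃} : Finset (Set α)), T) ⊆
          M.closure (L₁ ∪ L₂ ∪ L₃) \ {x} := by
        intro u hu
        rcases hu with hu | hu
        · rw [Set.mem_singleton_iff] at hu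
          subst hu
          exact ⟨hvH, fun h => hvC (by rw [Set.mem_singleton_iff] at h; rw [h]; exact Or.inl (Or.inl h1.2.2))⟩
        · simp only [Set.mem_iUnion, Finset.mem_insert, Finset.mem_singleton, exists_prop] at hu
          obtain ⟨T, hT, huT⟩ := hu
          have hTv' : T ∈ ThmN.trianglesThrough M v := by rcases hT with rfl | rfl | rfl <;> (rw [hTv]; simp)
          obtain ⟨hTH, hxT⟩ := hvT T hTv'
          exact ⟨hTH huT, fun h => hxT (by rw [Set.mem_singleton_iff] at h; rw [← h]; exact huT)⟩
      have hHx : (M.closure (L₁ ∪ L₂ ∪ L₃) \ {x}).ncard = 7 := by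
        rw [Set.ncard_sdiff_singleton_of_mem (hCH (Or.inl (Or.inl h1.2.2))), hH8']
      have heqU : ({v} ∪ ⋃ T ∈ ({T₁, T₂, T₃} : Finset (Set α)), T) = M.closure (L₁ ∪ L₂ ∪ L₃) \ {x} :=
        Set.eq_of_subset_of_ncard_le hsubU (by rw [hcoverU, hHx]) (hHfin.subset Set.sdiff_subset)
      have hzin : z ∈ ({v} ∪ ⋃ T ∈ ({T₁, T₂, T₃} : Finset (Set α)), T) := by
        rw [heqU]
        exact ⟨hCH hzC, fun h => hzx (Set.mem_singleton_iff.1 h)⟩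
      rcases hzin with hzv | hzin
      · rw [Set.mem_singleton_iff] at hzv
        exact absurd (hzv ▸ hzC) hvC
      · simp only [Set.mem_iUnion, Finset.mem_insert, Finset.mem_singleton, exists_prop] at hzin
        obtain ⟨T, hT, hzT⟩ := hzin
        rcases hT with rfl | rfl | rfl
        · exact Or.inl hzT
        · exact Or.inr (Or.inl hzT)
        · exact Or.inr (Or.inr hzT)
    -- the points of `C ∖ {x}` all lie on triangles through `v`, which lie in `C ∪ {v}` and avoid `x`
    have hpick : ∀ z ∈ L₁ ∪ L₂ ∪ L₃, z ≠ x → ∃ T ∈ ThmN.trianglesThrough M v, z ∈ T := by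
      intro z hz hzx
      rcases hcover z hz hzx with h | h | h
      · exact ⟨T₁, by rw [hTv]; simp, h⟩
      · exact ⟨T₂, by rw [hTv]; simp, h⟩
      · exact ⟨T₃, by rw [hTv]; simp, h⟩
    have hTin : ∀ T ∈ ThmN.trianglesThrough M v, ∀ z ∈ T, z ≠ v → z ∈ L₁ ∪ L₂ ∪ L₃ ∧ z ≠ x := by
      intro T hT z hz hzv
      obtain ⟨hTH, hxT⟩ := hvT T hT
      refine ⟨?_, fun h => hxT (h ▸ hz)⟩
      by_contra hzC
      exact hzv (hHsub z (hTH hz) hzC)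
    exact no_three_triangles_through_v M hC1 hC2 hx h1 h2 h3 h12 h13 h23 hthree' hvE hvC hv3 hpick hTin

end S1

end PercRepro
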